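import Mathlib
import Literature.Geometry.Lorentzian.ReggeWheelerChannels
import Literature.Geometry.Lorentzian.ReggeWheelerTortoise
import Literature.Geometry.Lorentzian.ReggeWheelerHorizonMass
import Literature.Analysis.PDE.Wave1DNearWindowedChannel
import Summits.FinalStateConjecture.FinalStateConjecture.Theorems.PhotonSphereChannelsChannelsResolveTameDevelopmentsRPotentialRepulsion

/-!
# Crux `WindowedShellChannels` (W, item stmt-FinalStateConjecture-14085) — the NEAR HALF FOR THICK
# SHELLS, uniformly in the spin `s ≤ 2` and the angular number `ℓ ≥ s`

Support file (does not close the item; registered stub `stub_nearThickShell`, `--supports`).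

`WindowedShellChannels` asks, for every `M > 0` and every shell half-width `ρ > 0`, for a lag
`h(M,ρ)` and a constant `c(M,ρ) > 0` such that every Regge–Wheeler solution whose Cauchy data vanish
on the photon shell `{|x − x_c| ≤ ρ}` sends at least the fraction `c` of its energy through the
exterior channels from the LAGGED edges `x_c ± (ρ − h)`, counting both time directions. This file
proves the statement for data supported on the HORIZON SIDE of a THICK shell:

* `stub_nearThickShell` — for `ρ ≥ 21M`, every tortoise radius function, every `s ≤ 2`, `s ≤ ℓ` and
  every global `C²` Regge–Wheeler solution `ψ` with Cauchy data supported in `(−∞, x_c − ρ)`: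
  `(1/4) · E_total ≤ ch⁺(ρ − 16M) + ch⁻(ρ − 16M)` — lag `h = 16M`, constant `1/4`, no dependence on
  `s, ℓ`, infinite energy allowed.

Mechanism: the abstract windowed channel inequality on the growing side of a potential
(`Literature.Analysis.PDE.wave1D_nearWindowedChannel`: null-separated multipliers
`Z = α₀∂_u + β(v)∂_v` with a logistic `β`, `Wave1DNullMultiplier.lean`), whose only input about the
potential is `V′ ≥ 2κV` below the window top. For the Regge–Wheeler potentials (derivative from
`RW.hasDerivAt_linePotential` of `…RPotentialRepulsion`) this holds with
`κ = 1/(8M)` on `{x ≤ x_c − 5M}` (`deriv_linePotential_ge`): there `r(x) − 2M ≤ Me^{−2} ≤ M/7`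
(`ReggeWheeler.IsTortoiseRadius.sub_two_mul_le`) and, with `N = ℓ(ℓ+1)r + 2M(1 − s²) > 0`,
`V′ − V/(4M) = (r − 2M)[N(32M² − 12Mr − r²) + 4Mℓ(ℓ+1)r(r − 2M)]/(4Mr⁶) ≥ 0` for `r ≤ 15M/7`.
With `h = 16M` the abstract constant is `1 − 2e^{−κh/2} = 1 − 2/e ≥ 1/4`.

What this does NOT give (documented on the item): the far half (the null-multiplier linear
programme is infeasible on the inverse-square side) and thin shells `ρ < 21M` (the growth condition
fails near the peak of the barrier), which remain the crux's open core.
-/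

set_option linter.dupNamespace false

namespace Summit.FinalStateConjecture.FinalStateConjecture.Theorems

open MeasureTheory Set Filter Topology
open Literature.Geometry.Lorentzian Literature.Geometry.Lorentzian.ReggeWheeler Literature.Analysis.PDE

noncomputable section

namespace WindowedShellChannelsNear

variable {M : ℝ} {r : ℝ → ℝ} {xc : ℝ}

/-! ### The deep horizon side: `r ≤ 15M/7` and `V′ ≥ V/(4M)` for `x ≤ x_c − 5M` -/

/-- On `{x ≤ x_c − 5M}` the area radius is within `M/7` of the horizon radius: `r(x) ≤ 15M/7`.
[folklore] -/
theorem radius_le (hr : IsTortoiseRadius M r xc) {x : ℝ} (hx : x ≤ xc - 5 * M) :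
    r x ≤ 15 * M / 7 := by
  have hM := hr.mass_pos
  have hle := hr.sub_two_mul_le x
  -- `e^{1/2} e^{(x - xc)/2M} ≤ e^{-2} ≤ 1/7`
  have harg : (x - xc) / (2 * M) ≤ -(5 / 2) := by
    rw [div_le_iff₀ (by positivity)]
    linarith
  have hexp : Real.exp (1 / 2) * Real.exp ((x - xc) / (2 * M)) ≤ Real.exp (-2) := by
    rw [← Real.exp_add]
    exact Real.exp_le_exp.2 (by linarith)
  have h7 : (7 : ℝ) < Real.exp 2 := by
    have h := Real.exp_one_gt_d9
    have h2 : Real.exp 2 = Real.exp 1 * Real.exp 1 := by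
      rw [← Real.exp_add]; norm_num
    rw [h2]
    nlinarith [Real.exp_pos 1]
  have hinv : Real.exp (-2) ≤ 1 / 7 := by
    rw [Real.exp_neg, inv_eq_one_div, div_le_div_iff₀ (Real.exp_pos 2) (by norm_num), one_mul,
      one_mul]
    exact h7.le
  have : r x - 2 * M ≤ M * (1 / 7) := by
    calc r x - 2 * M ≤ M * Real.exp (1 / 2) * Real.exp ((x - xc) / (2 * M)) := hle
      _ = M * (Real.exp (1 / 2) * Real.exp ((x - xc) / (2 * M))) := by ring
      _ ≤ M * (1 / 7) := by
          exact mul_le_mul_of_nonneg_left (hexp.trans hinv) hM.le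
  linarith

/-- **Exponential-type growth of the Regge–Wheeler potentials deep on the horizon side**: for
`s ≤ ℓ` (any spin) and `x ≤ x_c − 5M`, `V′(x) ≥ V(x)/(4M)`, i.e. `2κV ≤ V′` with `κ = 1/(8M)`.
(With `r = r(x) ≤ 15M/7` and `N = ℓ(ℓ+1)r + 2M(1−s²) ≥ 2M(s+1) > 0`:
`V′ − V/(4M) = (r − 2M)[N(32M² − 12Mr − r²) + 4Mℓ(ℓ+1)r(r − 2M)]/(4Mr⁶) ≥ 0`.) [folklore] -/
theorem deriv_linePotential_ge (hr : IsTortoiseRadius M r xc) {s ℓ : ℕ} (hsℓ : s ≤ ℓ)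
    {x : ℝ} (hx : x ≤ xc - 5 * M) :
    2 * (1 / (8 * M)) * linePotential M s ℓ r x ≤ deriv (linePotential M s ℓ r) x := by
  have hM := hr.mass_pos
  have hM0 : M ≠ 0 := hM.ne'
  rw [(RW.hasDerivAt_linePotential hr s ℓ x).deriv, linePotential_apply]
  unfold rwPotential
  set ρ : ℝ := r x with hρdef
  have h2 : 2 * M < ρ := hr.two_mul_lt x
  have hρ0 : ρ ≠ 0 := by
    have : 0 < ρ := by linarith
    exact this.ne'
  have hρ15 : ρ ≤ 15 * M / 7 := radius_le hr hx
  set L : ℝ := (ℓ : ℝ) * ((ℓ : ℝ) + 1) with hL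
  set c : ℝ := (1 - (s : ℝ) ^ 2) * (2 * M) with hc
  -- the bracket and its sign
  have hL0 : 0 ≤ L := by simp only [hL]; positivity
  have hsl : (s : ℝ) ≤ ℓ := by exact_mod_cast hsℓ
  have hs0 : (0 : ℝ) ≤ s := by exact_mod_cast Nat.zero_le s
  have hLs : (s : ℝ) * ((s : ℝ) + 1) ≤ L := by
    simp only [hL]
    exact mul_le_mul hsl (by linarith) (by linarith) (by linarith)
  have hN : 0 < L * ρ + c := by
    have h1 : L * (2 * M) + c ≤ L * ρ + c := by nlinarith
    have h2' : 0 < L * (2 * M) + c := by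
      simp only [hc]
      nlinarith
    linarith
  have hQ : 0 ≤ 32 * M ^ 2 - 12 * M * ρ - ρ ^ 2 := by
    have hρpos : 0 < ρ := by linarith
    have hsq : ρ ^ 2 ≤ (15 * M / 7) ^ 2 := pow_le_pow_left₀ hρpos.le hρ15 2
    nlinarith
  have hbr : 0 ≤ (ρ - 2 * M) * ((L * ρ + c) * (32 * M ^ 2 - 12 * M * ρ - ρ ^ 2)
      + 4 * M * L * ρ * (ρ - 2 * M)) / (4 * M * ρ ^ 6) := by
    have hρpos : 0 < ρ := by linarith
    apply div_nonneg _ (by positivity)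
    apply mul_nonneg (by linarith)
    have : 0 ≤ 4 * M * L * ρ * (ρ - 2 * M) := by
      have := hM.le; have : 0 ≤ ρ - 2 * M := by linarith
      positivity
    nlinarith [mul_nonneg hN.le hQ]
  -- the identity
  have key : (2 * M / ρ ^ 2 * (L / ρ ^ 2 + c / ρ ^ 3)
        + (1 - 2 * M / ρ) * (-(2 * L) / ρ ^ 3 - 3 * c / ρ ^ 4)) * (1 - 2 * M / ρ)
      - 2 * (1 / (8 * M)) * ((1 - 2 * M / ρ) * (L / ρ ^ 2 + c / ρ ^ 3))
      = (ρ - 2 * M) * ((L * ρ + c) * (32 * M ^ 2 - 12 * M * ρ - ρ ^ 2)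
          + 4 * M * L * ρ * (ρ - 2 * M)) / (4 * M * ρ ^ 6) := by
    field_simp
    ring
  have hfin : 2 * (1 / (8 * M)) * ((1 - 2 * M / ρ) * (L / ρ ^ 2 + c / ρ ^ 3))
      ≤ (2 * M / ρ ^ 2 * (L / ρ ^ 2 + c / ρ ^ 3)
        + (1 - 2 * M / ρ) * (-(2 * L) / ρ ^ 3 - 3 * c / ρ ^ 4)) * (1 - 2 * M / ρ) := by
    rw [← key] at hbr
    linarith
  simpa only [hL, hc] using hfin

/-! ### The near half of `WindowedShellChannels` for thick shells -/

/-- **Stub `stub_nearThickShell` — the near (horizon-side) half of `WindowedShellChannels` for thick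
shells, uniformly in `s ≤ 2`, `ℓ ≥ s`.** For `M > 0`, `ρ ≥ 21M`, a tortoise radius function `r`
centred at `x_c`, `s ≤ 2`, `s ≤ ℓ`, and a global `C²` solution `ψ` of the Regge–Wheeler equation
`ψ_tt − ψ_xx + V_{s,ℓ}(r(x))ψ = 0` whose Cauchy data are supported in `(−∞, x_c − ρ)`:
`(1/4) · totalEnergy ≤ channelEnergy (aperture ρ − 16M, t → +∞) + channelEnergy (ρ − 16M, t → −∞)`.
(Abstract windowed channel inequality `wave1D_nearWindowedChannel` with window top
`x_w = x_c − ρ + 16M ≤ x_c − 5M`, lag `h = 16M`, `κ = 1/(8M)`; the near windows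
`{x < x_c − (ρ − 16M) − |t|}` lie inside the exterior regions `{(ρ − 16M) + |t| < |x − x_c|}`.)
[folklore in method; new] -/
theorem stub_nearThickShell : ∀ M : ℝ, 0 < M → ∀ ρ : ℝ, 21 * M ≤ ρ → ∀ (r : ℝ → ℝ) (xc : ℝ), IsTortoiseRadius M r xc → ∀ (s ℓ : ℕ), s ≤ 2 → s ≤ ℓ → ∀ ψ : ℝ → ℝ → ℝ, IsRWSolution M s ℓ r ψ → CauchyDataSupportedOn ψ (Set.Iio (xc - ρ)) → ENNReal.ofReal (1 / 4) * totalEnergy (linePotential M s ℓ r) ψ 0 ≤ channelEnergy (linePotential M s ℓ r) xc (ρ - 16 * M) ψ atTop + channelEnergy (linePotential M s ℓ r) xc (ρ - 16 * M) ψ atBot := by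
  intro M hM ρ hρ r xc hr s ℓ _ hsℓ ψ hψ hsupp
  set V : ℝ → ℝ := linePotential M s ℓ r with hV
  have hVC : ContDiff ℝ 1 V := RW.contDiff_one_linePotential hr s ℓ
  have hV0 : ∀ x, 0 ≤ V x := fun x => linePotential_nonneg hM.le hsℓ hr.two_mul_lt x
  have hκ : (0 : ℝ) ≤ 1 / (8 * M) := by positivity
  have hh : (0 : ℝ) ≤ 16 * M := by positivity
  -- window top `xw = xc - (ρ - 16M) ≤ xc - 5M`
  set xw : ℝ := xc - (ρ - 16 * M) with hxw
  have hmono : ∀ x, x ≤ xw → 2 * (1 / (8 * M)) * V x ≤ deriv V x := fun x hx =>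
    deriv_linePotential_ge hr hsℓ (by simp only [hxw] at hx; linarith)
  have hsol : ∀ t x, iteratedDeriv 2 (fun τ => ψ τ x) t - iteratedDeriv 2 (ψ t) x + V x * ψ t x = 0 :=
    fun t x => hψ.2 (t, x)
  have hsupp' : ∀ x, xw - 16 * M ≤ x → ψ 0 x = 0 ∧ deriv (fun τ => ψ τ x) 0 = 0 := by
    intro x hx
    refine hsupp x ?_
    simp only [mem_Iio, not_lt]
    simp only [hxw] at hx
    linarith
  have key := wave1D_nearWindowedChannel hVC hV0 hκ hh hmono hψ.1 hsol hsupp'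
  -- the constant: `1/4 ≤ 1 - 2 e^{-1}`
  have hexp : -(1 / (8 * M) * (16 * M) / 2) = (-1 : ℝ) := by field_simp; ring
  rw [hexp] at key
  have hconst : ENNReal.ofReal (1 / 4) ≤ ENNReal.ofReal (1 - 2 * Real.exp (-1)) := by
    apply ENNReal.ofReal_le_ofReal
    have h := Real.exp_one_gt_d9
    have hinv : Real.exp (-1) = (Real.exp 1)⁻¹ := Real.exp_neg 1
    rw [hinv]
    rw [show (1 : ℝ) - 2 * (Real.exp 1)⁻¹ = 1 - 2 / Real.exp 1 by ring]
    have : 2 / Real.exp 1 ≤ 3 / 4 := by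
      rw [div_le_div_iff₀ (Real.exp_pos 1) (by norm_num)]
      linarith
    linarith
  -- the near windows lie inside the exterior regions
  have hsub : ∀ t : ℝ, Iio (xw - |t|) ⊆ {x : ℝ | (ρ - 16 * M) + |t| < |x - xc|} := by
    intro t x hx
    rw [mem_Iio, hxw] at hx
    rw [mem_setOf_eq]
    have h1 : xc - x ≤ |x - xc| := by
      rw [abs_sub_comm]
      exact le_abs_self _
    linarith
  have htop : liminf (fun t => ∫⁻ x in Iio (xw - t), ENNReal.ofReal
        (deriv (fun τ => ψ τ x) t ^ 2 + deriv (ψ t) x ^ 2 + V x * ψ t x ^ 2)) atTop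
      ≤ channelEnergy V xc (ρ - 16 * M) ψ atTop := by
    unfold channelEnergy exteriorEnergy energyDensity
    refine liminf_le_liminf ?_
    filter_upwards [eventually_ge_atTop 0] with t ht
    have hs' : Iio (xw - t) ⊆ {x : ℝ | (ρ - 16 * M) + |t| < |x - xc|} := by
      have : xw - t = xw - |t| := by rw [abs_of_nonneg ht]
      rw [this]
      exact hsub t
    exact lintegral_mono_set hs'
  have hbot : liminf (fun t => ∫⁻ x in Iio (xw + t), ENNReal.ofReal
        (deriv (fun τ => ψ τ x) t ^ 2 + deriv (ψ t) x ^ 2 + V x * ψ t x ^ 2)) atBot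
      ≤ channelEnergy V xc (ρ - 16 * M) ψ atBot := by
    unfold channelEnergy exteriorEnergy energyDensity
    refine liminf_le_liminf ?_
    filter_upwards [eventually_le_atBot 0] with t ht
    have hs' : Iio (xw + t) ⊆ {x : ℝ | (ρ - 16 * M) + |t| < |x - xc|} := by
      have : xw + t = xw - |t| := by rw [abs_of_nonpos ht]; ring
      rw [this]
      exact hsub t
    exact lintegral_mono_set hs'
  have htot : totalEnergy V ψ 0 = ∫⁻ x, ENNReal.ofReal
      (deriv (fun τ => ψ τ x) 0 ^ 2 + deriv (ψ 0) x ^ 2 + V x * ψ 0 x ^ 2) := rfl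
  calc ENNReal.ofReal (1 / 4) * totalEnergy V ψ 0
      ≤ ENNReal.ofReal (1 - 2 * Real.exp (-1)) * totalEnergy V ψ 0 := by gcongr
    _ ≤ _ := by rw [htot]; exact key
    _ ≤ channelEnergy V xc (ρ - 16 * M) ψ atTop + channelEnergy V xc (ρ - 16 * M) ψ atBot :=
        add_le_add htop hbot

end WindowedShellChannelsNear

end

end Summit.FinalStateConjecture.FinalStateConjecture.Theorems
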